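import Summits.HodgeConjecture.HodgeConjecture.Theses.LinearSystemTorelli
import Summits.HodgeConjecture.HodgeConjecture.Theses.QbarEnvelope

/-!
# Sketch — crux idea `weakly-nonfactor-descent` for crux stmt-HodgeConjecture-2409
(`LinearSystemTorelli.MiddleDivisorSupportFourfold`), round 2, ideator 5.

First lemma of the line (typed over existing declarations, no new vocabulary):

  EnvelopeFourfoldCodimTwo → HCOverNumberFieldsCodimTwo → PullbackAlgebraicCodimTwo → crux

where the three antecedents are the `(n, p) = (4, 2)` / `p = 2` instances of the items
`Envelope` (stmt-1069), `HCOverNumberFields` (stmt-1070) and `PullbackAlgebraic` (stmt-1071) of route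
`QbarEnvelope`, and the last step `algebraicClasses X 2 ≤ supportedClasses X 4 1` is
`supportedClasses_mono` (codimension-2 economy: for THIS crux "divisor-supported" costs nothing
beyond "algebraic"). Also recorded: each instance follows from the route item (sanity), so a lead may
register either the shared items verbatim or the weaker instances.
-/

namespace Summit.HodgeConjecture.HodgeConjecture.Cruxes.MiddleDivisorSupportFourfold.WeaklyNonFactorDescent

open CategoryTheory
open Literature.AlgebraicGeometry Literature.AlgebraicGeometry.Motives
open Literature.AlgebraicGeometry.HodgeTheory

/-- "Definable over a number field" for a `ℂ`-scheme, verbatim the clause used by route `QbarEnvelope`. -/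
def IsDefinableOverNumberField (W : SchemeOver ℂ) : Prop :=
  ∃ (K : Type) (_ : Field K) (_ : NumberField K) (σ : K →+* ℂ) (W₀ : SchemeOver K),
    Nonempty (W ≅ (baseChangeHom σ).obj W₀)

/-- TRANSFER stub (the `(4,2)` instance of `QbarEnvelope.Envelope`): every rational `(2,2)`-class on a
smooth projective complex fourfold is the pull-back, along some `ℂ`-morphism `ι : X ⟶ W` into a smooth
projective variety `W` (of any dimension) definable over a number field, of a rational `(2,2)`-class on
`W`. THEOREM (KOU 2023 Thm 1.12(a) + Charles–Schnell Thm 11.3.19 / Voisin 2007 Prop. 1.7) whenever the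
Hodge-locus component of `c` in a `ℚ`-family through `X` is weakly non-factor; OPEN exactly on the
period-rigid / factor residue (isolated special points). -/
def EnvelopeFourfoldCodimTwo : Prop :=
  ∀ ⦃X : SchemeOver ℂ⦄, IsSmoothProjective 4 X → ∀ (c : complexBetti X 4), IsRationalClass c →
    IsOfHodgeType 4 X 4 2 2 c →
      ∃ (m : ℕ) (W : SchemeOver ℂ) (ι : X ⟶ W) (c' : complexBetti W 4), IsSmoothProjective m W ∧
        IsDefinableOverNumberField W ∧ IsRationalClass c' ∧ IsOfHodgeType m W 4 2 2 c' ∧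
          complexBetti.map ι 4 c' = c

/-- SECTOR stub (codimension-2 slice of `QbarEnvelope.HCOverNumberFields`, all dimensions — the slice
cannot be cut down to fourfolds: over `ℚ̄` the pencil/Hilbert-scheme dimension reduction fails for
countability reasons, see the card): rational `(2,2)`-classes on smooth projective varieties definable
over a number field are algebraic. -/
def HCOverNumberFieldsCodimTwo : Prop :=
  ∀ ⦃m : ℕ⦄ ⦃W : SchemeOver ℂ⦄, IsSmoothProjective m W → IsDefinableOverNumberField W →
    ∀ (c' : complexBetti W 4), IsRationalClass c' → IsOfHodgeType m W 4 2 2 c' →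
      c' ∈ algebraicClasses W 2

/-- GLUE (theorem in print, `p = 2` instance of `QbarEnvelope.PullbackAlgebraic`; Fulton Ch. 6, §8.1,
Cor. 19.2): pull-back along a `ℂ`-morphism of smooth projective varieties preserves codimension-2
algebraic classes. -/
def PullbackAlgebraicCodimTwo : Prop :=
  ∀ ⦃n : ℕ⦄ ⦃X : SchemeOver ℂ⦄, IsSmoothProjective n X → ∀ ⦃m : ℕ⦄ ⦃W : SchemeOver ℂ⦄,
    IsSmoothProjective m W → ∀ (ι : X ⟶ W) (c' : complexBetti W 4),
      c' ∈ algebraicClasses W 2 → complexBetti.map ι 4 c' ∈ algebraicClasses X 2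

/-- Sanity: the transfer stub is the `(4,2)` instance of the route item `QbarEnvelope.Envelope`. -/
theorem envelopeFourfoldCodimTwo_of_envelope (h : Theses.QbarEnvelope.Envelope) :
    EnvelopeFourfoldCodimTwo := by
  intro X hX c hc hh
  obtain ⟨m, W, ι, c', hW, hK, hc', hh', hmap⟩ := h hX 2 c hc hh
  exact ⟨m, W, ι, c', hW, hK, hc', hh', hmap⟩

/-- Sanity: the sector stub is implied by the route item `QbarEnvelope.HCOverNumberFields`. -/
theorem hcOverNumberFieldsCodimTwo_of_hcOverNumberFields (h : Theses.QbarEnvelope.HCOverNumberFields) :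
    HCOverNumberFieldsCodimTwo := by
  intro m W hW hK c' hc' hh'
  exact (h hW hK).2 2 c' hc' hh'

/-- Sanity: the glue is the `p = 2` instance of the route item `QbarEnvelope.PullbackAlgebraic`. -/
theorem pullbackAlgebraicCodimTwo_of_pullbackAlgebraic (h : Theses.QbarEnvelope.PullbackAlgebraic) :
    PullbackAlgebraicCodimTwo := by
  intro n X hX m W hW ι c' hc'
  exact h hX hW ι 2 c' hc'

/-- FIRST LEMMA of the line (proved): transfer + sector + glue conclude the crux BY NAME. The last
step is the codimension-2 economy `algebraicClasses X 2 = N²H⁴ ≤ N¹H⁴ = supportedClasses X 4 1`. -/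
theorem middleDivisorSupportFourfold_of (hE : EnvelopeFourfoldCodimTwo)
    (hQ : HCOverNumberFieldsCodimTwo) (hP : PullbackAlgebraicCodimTwo) :
    Theses.LinearSystemTorelli.MiddleDivisorSupportFourfold := by
  intro X hX c hc hh
  obtain ⟨m, W, ι, c', hW, hK, hc', hh', hmap⟩ := hE hX c hc hh
  have h1 : c' ∈ algebraicClasses W 2 := hQ hW hK c' hc' hh'
  have h2 : complexBetti.map ι 4 c' ∈ algebraicClasses X 2 := hP hX hW ι c' h1
  rw [hmap] at h2
  exact supportedClasses_mono X 4 (by norm_num : 1 ≤ 2) h2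

/-- The same, directly from the three items of route `QbarEnvelope` (shared stubs). -/
theorem middleDivisorSupportFourfold_of_qbarEnvelope (hE : Theses.QbarEnvelope.Envelope)
    (hQ : Theses.QbarEnvelope.HCOverNumberFields) (hP : Theses.QbarEnvelope.PullbackAlgebraic) :
    Theses.LinearSystemTorelli.MiddleDivisorSupportFourfold :=
  middleDivisorSupportFourfold_of (envelopeFourfoldCodimTwo_of_envelope hE)
    (hcOverNumberFieldsCodimTwo_of_hcOverNumberFields hQ)
    (pullbackAlgebraicCodimTwo_of_pullbackAlgebraic hP)

end Summit.HodgeConjecture.HodgeConjecture.Cruxes.MiddleDivisorSupportFourfold.WeaklyNonFactorDescent
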